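import Literature.RingTheory.HilbertSamuel.ProjDirectrixPlane
import Literature.RingTheory.HilbertSamuel.TangentConeChangeOfGenerators
import Literature.RingTheory.MvPolynomial.DirectrixDimension
import Mathlib.RingTheory.MvPolynomial.Homogeneous
import Mathlib.RingTheory.Polynomial.Quotient
import Mathlib.RingTheory.Localization.AtPrime.Basic
import HarnessLib

/-!
# `e(A) = 2`: on a blow-up chart, the ring of `ℙ(Dir(A))` is a polynomial ring in one variable over the residue
# field — `D/𝔑 ≅ k[T]` (CJS 2020, Def. 6.34 (i) / Def. 6.38 (ii): «`C_1 = ℙ(Dir_x(X)) ≅ ℙ^1_{k(x)}`», p. 103, p. 105)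

Topic: `Literature/RingTheory/HilbertSamuel`. Continuation of `ProjDirectrixPlane.lean` (the adapted pair `c_j, c_{j'}`)
and `ProjDirectrixGenerators.lean`, ring-level core of the tree proof of the named fact
`Literature.AlgebraicGeometry.CossartJannsenSaito2020.ProjDir_projLine`. SETTING (an ABSTRACT CHART, as in
`Resolution/PointBlowupHilbertSamuel.lean`): `R` a ring with a maximal ideal `𝔭 = (c_1, …, c_r)`, `A = R_𝔭` (noetherian
local, residue field `k`), a minimal system of generators `x` of `𝔪 = 𝔭A` with expansions `c_l = Σ_i a_{li} x_i` and
symbols `s_l = Σ_i ā_{li} X_i`, `𝒯 = 𝒯(J_x)` the directrix space, `e(A) = 2`, an adapted pair `s_j ∉ 𝒯`,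
`s_{j'} ∉ 𝒯 + k s_j`;
and chart data `(D, ψ : R → D, e_1, …, e_r)` with `ψ(c_l) = ψ(c_j) e_l`, `e_j = 1`, `ψ(c_j)` a nonzerodivisor, every element
of `D` of the form `F(e)` for a form `F ∈ R[Y_1, …, Y_r]`, `ψ(F(c)) = ψ(c_j)^m F(e)` for forms of degree `m`, and
`ψ(z) = 0 ⇒ c_j^K z = 0` (all satisfied by the Rees chart `R[𝔭t]_{(c_j t)}`, `BlowupChartQuasiRegular.lean`). Let
`𝔑 = 𝔭D + (Σ_l λ_l e_l : λ ∈ R^r, Σ_l λ̄_l s_l ∈ 𝒯) ⊆ D` be the ideal of `ℙ(Dir) ∩ Spec D`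
(`CossartJannsenSaito2020/ProjDirClosed.lean`, `mem_projDirectrixFibre_chart_iff`). PROVED:

* the symbol map `Φ : R[Y] → k[X]` (written out as an `MvPolynomial.eval₂Hom`), `Y_l ↦ s_l` — the symbol of a form in
  the `c_l` read in the minimal generators; a form
  `H` of degree `d` with `H(c) ∈ 𝔪^{d+1}` has `Φ(H) ∈ J_x` (`symbolHom_mem_tangentConeIdeal`), and `J_x ⊆ 𝒯·k[X]`
  (`tangentConeIdeal_le_span_directrixSpace`);
* `exists_form_symbolHom_mem_of_mem_chartIdeal` — every element of `𝔑` is `F(e)` for a form `F` with `Φ(F) ∈ 𝒯·k[X]`;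
  `symbolHom_sub_mem_of_eval₂_eq` — two forms with the same value in `D` have symbols congruent modulo `J_x` up to
  powers of `s_j`;
* `exists_lineMap` — `ρ : k[X] → k[T]`, `X_i ↦ α_i + β_i T` where `X_i ≡ α_i s_j + β_i s_{j'} (mod 𝒯)` — a `k`-algebra map
  KILLING `𝒯` with `ρ(s_j) = 1`, `ρ(s_{j'}) = T` (the restriction to the line `ℙ(Dir) ≅ ℙ^1` in the chart `s_j ≠ 0`);
* `coeff_mem_of_eval₂_mem_chartIdeal` (INJECTIVITY) — if `Σ_s ψ(p_s) t^s ∈ 𝔑` (`t = e_{j'}`) then every `p_s ∈ 𝔭`;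
  `exists_polynomial_sub_eval₂_mem_chartIdeal` (SURJECTIVITY) — every element of `D` is `≡ Σ ψ(p_s) t^s (mod 𝔑)`;
* **`exists_ringEquiv_polynomial_quotient_chartIdeal`** — `k[T] ≅ D/𝔑` with `T ↦ t` and `r̄ ↦ ψ(r)`: the ring of
  `ℙ(Dir(A))` on the chart is the polynomial ring in `t = c_{j'}/c_j` over `k = R/𝔭`.

Everything here is PROVED; no definitions (the ideal `𝔑` and the symbol map are written out) and no named facts.
NOT a statement of H. Hironaka's manuscript. AI-written; weaker than expert review.

## References

* V. Cossart, U. Jannsen, S. Saito, *Desingularization: Invariants and Strategy*, LNM 2270 (2020), Lemma 2.7,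
  Def. 2.18, Def. 6.34 (i), Def. 6.38 (ii), p. 103, p. 105. [CossartJannsenSaito2020]
* The Stacks Project, Tag 0804 (charts of a blowing up). [StacksProject]
-/

noncomputable section

open IsLocalRing MvPolynomial Module
open Literature.AlgebraicGeometry.Resolution Literature.RingTheory.MvPolynomial

namespace Literature.RingTheory.HilbertSamuel

universe u v w

/-! ## Linear forms: coefficients and sums (private copies) -/

section LinearForms

variable {k : Type v} [Field k] {e : ℕ}

/-- The `X_i`-coefficient of `Σ v_j X_j` is `v_i`. [folklore] -/
private theorem coeff_single_linForm₃ (v : Fin e → k) (i : Fin e) :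
    MvPolynomial.coeff (Finsupp.single i 1) (linForm v) = v i := by
  classical
  rw [linForm_apply, MvPolynomial.coeff_sum]
  simp_rw [MvPolynomial.coeff_smul, MvPolynomial.coeff_X, smul_eq_mul]
  rw [Finset.sum_eq_single i]
  · simp
  · intro j _ hj
    rw [if_neg, mul_zero]
    exact fun h => hj (Finsupp.single_left_injective one_ne_zero h)
  · exact fun h => absurd (Finset.mem_univ i) h

/-- A form of degree `1` is the linear form of its `X_i`-coefficients. [folklore] -/
private theorem eq_linForm_coeff₃ {L : MvPolynomial (Fin e) k} (hL : L ∈ homogeneousSubmodule (Fin e) k 1) :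
    L = linForm fun i => MvPolynomial.coeff (Finsupp.single i 1) L := by
  have hL' : L ∈ LinearMap.range (linForm (K := k) (n := e)) := by rwa [range_linForm]
  obtain ⟨v, rfl⟩ := hL'
  congr 1
  funext i
  rw [coeff_single_linForm₃]

/-- `linForm v = Σ_i C(v_i) X_i`. [folklore] -/
private theorem linForm_eq_sum_C_mul (v : Fin e → k) :
    linForm v = ∑ i, C (v i) * (X i : MvPolynomial (Fin e) k) := by
  rw [linForm_apply]
  exact Finset.sum_congr rfl fun i _ => by rw [smul_eq_C_mul]

end LinearForms

/-! ## The setting: `A = R_𝔭`, minimal generators, expansions of the `c_l`, the symbol map -/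

section Setting

variable {R : Type u} [CommRing R] (𝔭 : Ideal R) [𝔭.IsMaximal]
  (A : Type u) [CommRing A] [IsLocalRing A] [IsNoetherianRing A] [Algebra R A] [IsLocalization.AtPrime A 𝔭]
  {n : ℕ} {x : Fin n → A} (hx : Ideal.span (Set.range x) = maximalIdeal A)
  {r : ℕ} {c : Fin r → R} (a : Fin r → Fin n → A)

omit [IsNoetherianRing A] in
include 𝔭 in
/-- Residues of elements of `R` exhaust the residue field of `A = R_𝔭` (`𝔭` maximal). [folklore] -/
private theorem exists_residue_algebraMap_eq (q : ResidueField A) : ∃ ρ : R, residue A (algebraMap R A ρ) = q := by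
  have h𝔭max : 𝔭.IsMaximal := ‹_›
  obtain ⟨a₀, rfl⟩ := Ideal.Quotient.mk_surjective q
  obtain ⟨⟨ρ, s⟩, hρs⟩ := IsLocalization.surj 𝔭.primeCompl a₀
  obtain ⟨y, i, hi, hyi⟩ := h𝔭max.exists_inv s.2
  refine ⟨y * ρ, ?_⟩
  change residue A _ = residue A a₀
  rw [← sub_eq_zero, ← map_sub, residue_eq_zero_iff]
  have hs : a₀ * algebraMap R A s = algebraMap R A ρ := hρs
  have h1 : algebraMap R A (y * ρ) - a₀ = -(algebraMap R A i * a₀) +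
      (algebraMap R A y * algebraMap R A s + algebraMap R A i - 1) * a₀ := by
    rw [map_mul]
    linear_combination (-(algebraMap R A y)) * hs
  have h2 : algebraMap R A y * algebraMap R A s + algebraMap R A i - 1 = 0 := by
    rw [← map_mul, ← map_add, hyi, map_one, sub_self]
  rw [h1, h2, zero_mul, add_zero]
  exact Submodule.neg_mem _ (Ideal.mul_mem_right _ _
    ((IsLocalization.AtPrime.to_map_mem_maximal_iff A 𝔭 i).mpr hi))

omit [IsNoetherianRing A] in
/-- `Φ(Y_l) = s_l` for the symbol map `Φ : R[Y] → k[X]`, `Y_l ↦ s_l`. [folklore] -/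
private theorem chartSymbolMap_X (l : Fin r) :
    (MvPolynomial.eval₂Hom (MvPolynomial.C.comp ((residue A).comp (algebraMap R A)))
          (fun l => linForm fun i => residue A (a l i))) (X l : MvPolynomial (Fin r) R) =
      linForm fun i => residue A (a l i) := by
  simp

omit [IsNoetherianRing A] in
/-- `Φ(r) = r̄` for the symbol map. [folklore] -/
private theorem chartSymbolMap_C (ρ : R) :
    (MvPolynomial.eval₂Hom (MvPolynomial.C.comp ((residue A).comp (algebraMap R A)))
          (fun l => linForm fun i => residue A (a l i))) (C ρ : MvPolynomial (Fin r) R) =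
      C (residue A (algebraMap R A ρ)) := by
  simp

omit [IsNoetherianRing A] in
/-- The symbol of the linear form `Σ_l λ_l Y_l` is `Σ_i (Σ_l λ̄_l ā_{li}) X_i` (the symbol of the combination
`Σ_l λ_l c_l`, `ProjDirectrixGenerators.lean`). [cite: CossartJannsenSaito2020, §2.2 (p. 27)] -/
theorem symbolHom_sum_C_mul_X (lam : Fin r → R) :
    (MvPolynomial.eval₂Hom (MvPolynomial.C.comp ((residue A).comp (algebraMap R A)))
          (fun l => linForm fun i => residue A (a l i))) (∑ l, C (lam l) * X l) =
      linForm fun i => ∑ l, residue A (algebraMap R A (lam l)) * residue A (a l i) := by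
  rw [map_sum]
  simp_rw [map_mul, chartSymbolMap_C, chartSymbolMap_X]
  have h : (fun i => ∑ l, residue A (algebraMap R A (lam l)) * residue A (a l i)) =
      ∑ l, residue A (algebraMap R A (lam l)) • fun i => residue A (a l i) := by
    funext i
    simp [Finset.sum_apply, Pi.smul_apply, smul_eq_mul]
  rw [h, map_sum]
  exact Finset.sum_congr rfl fun l _ => by rw [map_smul, smul_eq_C_mul]

variable (ha : ∀ l, ∑ i, a l i * x i = algebraMap R A (c l))

omit [IsNoetherianRing A] in
include hx ha in
/-- **A form in the `c_l` with value in `𝔪^{d+1}` has its symbol in the tangent cone ideal**: for `H ∈ R[Y]` homogeneous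
of degree `d` with `H(c) ∈ 𝔪^{d+1}` (in `A`), `Φ(H) ∈ J_x` — substitute `Y_l ↦ Σ_i a_{li} X_i` to get a form `H̃ ∈ A[X]` of
degree `d` with `H̃(x) = H(c)`, and reduce (`mem_symbolForms_iff_exists_form`).
[cite: CossartJannsenSaito2020, §2.2 (p. 27)] -/
theorem symbolHom_mem_tangentConeIdeal {d : ℕ} {H : MvPolynomial (Fin r) R} (hH : H.IsHomogeneous d)
    (hHc : algebraMap R A (MvPolynomial.eval c H) ∈ maximalIdeal A ^ (d + 1)) :
    (MvPolynomial.eval₂Hom (MvPolynomial.C.comp ((residue A).comp (algebraMap R A)))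
          (fun l => linForm fun i => residue A (a l i))) H ∈ tangentConeIdeal x hx := by
  -- the substituted form `H̃ ∈ A[X]`
  let linA : Fin r → MvPolynomial (Fin n) A := fun l => ∑ i, C (a l i) * X i
  let Htil : MvPolynomial (Fin n) A := MvPolynomial.eval₂Hom (MvPolynomial.C.comp (algebraMap R A)) linA H
  have hlin : ∀ l, (linA l).IsHomogeneous 1 := fun l =>
    IsHomogeneous.sum _ _ _ fun i _ => isHomogeneous_C_mul_X _ _
  have hHtil : Htil.IsHomogeneous d := by
    have h := hH.eval₂ (MvPolynomial.C.comp (algebraMap R A)) linA (fun ρ => isHomogeneous_C _ _) hlin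
    rwa [one_mul] at h
  -- `H̃(x) = H(c)`
  have heval : MvPolynomial.eval x Htil = algebraMap R A (MvPolynomial.eval c H) := by
    have hhom : (MvPolynomial.eval x).comp (MvPolynomial.eval₂Hom (MvPolynomial.C.comp (algebraMap R A)) linA) =
        (algebraMap R A).comp (MvPolynomial.eval c) := by
      refine MvPolynomial.ringHom_ext (fun ρ => ?_) (fun l => ?_)
      · simp
      · simp only [RingHom.comp_apply, MvPolynomial.eval₂Hom_X', MvPolynomial.eval_X, linA]
        rw [map_sum]
        simp_rw [map_mul, MvPolynomial.eval_C, MvPolynomial.eval_X]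
        exact ha l
    exact RingHom.congr_fun hhom H
  -- reduce
  have hred : MvPolynomial.map (residue A) Htil =
      (MvPolynomial.eval₂Hom (MvPolynomial.C.comp ((residue A).comp (algebraMap R A)))
          (fun l => linForm fun i => residue A (a l i))) H := by
    have hhom : (MvPolynomial.map (residue A)).comp
        (MvPolynomial.eval₂Hom (MvPolynomial.C.comp (algebraMap R A)) linA) =
        (MvPolynomial.eval₂Hom (MvPolynomial.C.comp ((residue A).comp (algebraMap R A)))
          (fun l => linForm fun i => residue A (a l i))) := by
      refine MvPolynomial.ringHom_ext (fun ρ => ?_) (fun l => ?_)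
      · simp
      · simp only [RingHom.comp_apply, MvPolynomial.eval₂Hom_X', linA, map_sum, map_mul,
          MvPolynomial.map_C, MvPolynomial.map_X, linForm_eq_sum_C_mul]
    exact RingHom.congr_fun hhom H
  rw [← hred]
  refine mem_tangentConeIdeal_of_mem_symbolForms x hx d ?_
  exact (mem_symbolForms_iff_exists_form x hx).mpr ⟨Htil, hHtil, heval ▸ hHc, rfl⟩

omit [IsNoetherianRing A] in
include hx in
/-- **`J_x ⊆ 𝒯(J_x) · k[X]`**: the tangent cone ideal lies in the irrelevant ideal (a form `F` of degree `d` with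
`F(x) ∈ 𝔪^{d+1}` has constant coefficient in `𝔪`), hence is generated inside `k[𝒯]` by elements without constant term
(`le_span_directrixSpace`, CJS Def. 2.8 «`Dir ⊆ C`»). [cite: CossartJannsenSaito2020, Def. 2.8, Def. 2.18] -/
theorem tangentConeIdeal_le_span_directrixSpace :
    tangentConeIdeal x hx ≤
      Ideal.span (directrixSpace (tangentConeIdeal x hx) : Set (MvPolynomial (Fin n) (ResidueField A))) := by
  refine le_span_directrixSpace ?_
  -- `J ≤ ker constantCoeff`
  unfold tangentConeIdeal
  rw [Ideal.span_le]
  intro f hf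
  obtain ⟨d, hfd⟩ := Set.mem_iUnion.mp hf
  obtain ⟨F, -, hFx, rfl⟩ := (mem_symbolForms_iff_exists_form x hx).mp hfd
  rw [SetLike.mem_coe, RingHom.mem_ker, ← MvPolynomial.eval_zero]
  -- `constantCoeff (map residue F) = residue (F(x))` since `x_i ∈ 𝔪`
  have hxres : (fun i => residue A (x i)) = 0 := by
    funext i
    exact (residue_eq_zero_iff _).mpr (hx ▸ Ideal.subset_span ⟨i, rfl⟩)
  have h1 : MvPolynomial.eval (0 : Fin n → ResidueField A) (MvPolynomial.map (residue A) F) =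
      residue A (MvPolynomial.eval x F) := by
    have hhom : (MvPolynomial.eval (0 : Fin n → ResidueField A)).comp (MvPolynomial.map (residue A)) =
        (residue A).comp (MvPolynomial.eval x) := by
      refine MvPolynomial.ringHom_ext (fun ρ => ?_) (fun i => ?_)
      · simp
      · simp only [RingHom.comp_apply, MvPolynomial.map_X, MvPolynomial.eval_X, Pi.zero_apply]
        exact (congrFun hxres i).symm
    exact RingHom.congr_fun hhom F
  change MvPolynomial.eval 0 (MvPolynomial.map (residue A) F) = 0
  rw [h1, residue_eq_zero_iff]
  exact Ideal.pow_le_self (Nat.succ_ne_zero d) hFx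

end Setting

/-! ## The line map `ρ : k[X] → k[T]` killing the directrix forms -/

section LineMap

variable {A : Type u} [CommRing A] [IsLocalRing A] {n : ℕ} {x : Fin n → A}
  (hx : Ideal.span (Set.range x) = maximalIdeal A) {r : ℕ} (a : Fin r → Fin n → A) {j j' : Fin r}
  (hj : linForm (fun i => residue A (a j i)) ∉ directrixSpace (tangentConeIdeal x hx))
  (hj' : linForm (fun i => residue A (a j' i)) ∉
    directrixSpace (tangentConeIdeal x hx) ⊔ (ResidueField A) ∙ linForm (fun i => residue A (a j i)))
  (hd : directrixDim (tangentConeIdeal x hx) = 2)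

include hj hj' hd in
/-- **The line map** `ρ : k[X_1, …, X_n] → k[T]`, `X_i ↦ α_i + β_i T`, where `X_i ≡ α_i s_j + β_i s_{j'} (mod 𝒯)` are the
coordinates of `X_i` in `S_1 = 𝒯 ⊕ k s_j ⊕ k s_{j'}` (`exists_sub_sub_mem_of_pair`): restriction of functions on `ℙ(T(A))`
to the line `ℙ(Dir(A)) ≅ ℙ^1` in the affine coordinate `T = s_{j'}/s_j`. It KILLS the directrix forms (hence `𝒯·k[X]`) and
sends `s_j ↦ 1`, `s_{j'} ↦ T`; more generally `ρ(L) = α + β T` whenever `L ≡ α s_j + β s_{j'} (mod 𝒯)` (uniqueness of the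
coordinates, `eq_zero_of_pair_mem`). [cite: CossartJannsenSaito2020, Def. 2.18, Def. 6.38 (ii)] -/
theorem exists_lineMap :
    ∃ ρ : MvPolynomial (Fin n) (ResidueField A) →ₐ[ResidueField A] Polynomial (ResidueField A),
      (∀ f ∈ Ideal.span (directrixSpace (tangentConeIdeal x hx) : Set (MvPolynomial (Fin n) (ResidueField A))),
        ρ f = 0) ∧
      ρ (linForm fun i => residue A (a j i)) = 1 ∧ ρ (linForm fun i => residue A (a j' i)) = Polynomial.X := by
  classical
  set T := directrixSpace (tangentConeIdeal x hx) with hT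
  set sj := linForm (fun i => residue A (a j i)) with hsj
  set sj' := linForm (fun i => residue A (a j' i)) with hsj'
  -- the coordinates of the variables
  have hcoord := fun i : Fin n => exists_sub_sub_mem_of_pair hx a hj hj' hd (isHomogeneous_X (ResidueField A) i)
  choose αv βv hXi using hcoord
  let ρ : MvPolynomial (Fin n) (ResidueField A) →ₐ[ResidueField A] Polynomial (ResidueField A) :=
    MvPolynomial.aeval fun i => Polynomial.C (αv i) + Polynomial.C (βv i) * Polynomial.X
  have hρX : ∀ i, ρ (X i) = Polynomial.C (αv i) + Polynomial.C (βv i) * Polynomial.X :=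
    fun i => by simp only [ρ, MvPolynomial.aeval_X]
  -- `ρ(L) = α + β T` whenever `L ≡ α s_j + β s_j' (mod T)`
  have key : ∀ {L : MvPolynomial (Fin n) (ResidueField A)}, L ∈ homogeneousSubmodule (Fin n) (ResidueField A) 1 →
      ∀ {α β : ResidueField A}, L - α • sj - β • sj' ∈ T → ρ L = Polynomial.C α + Polynomial.C β * Polynomial.X := by
    intro L hL α β h
    -- write `L = Σ ℓ_i X_i`
    set ℓ : Fin n → ResidueField A := fun i => MvPolynomial.coeff (Finsupp.single i 1) L with hℓ
    have hLsum : L = ∑ i, C (ℓ i) * X i := by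
      conv_lhs => rw [eq_linForm_coeff₃ hL]
      exact linForm_eq_sum_C_mul (ℓ)
    have hρL : ρ L = Polynomial.C (∑ i, ℓ i * αv i) + Polynomial.C (∑ i, ℓ i * βv i) * Polynomial.X := by
      rw [hLsum, map_sum]
      simp_rw [map_mul, MvPolynomial.algHom_C, Polynomial.algebraMap_eq, hρX]
      rw [map_sum, map_sum, Finset.sum_mul, ← Finset.sum_add_distrib]
      exact Finset.sum_congr rfl fun i _ => by rw [Polynomial.C_mul, Polynomial.C_mul]; ring
    have hmemT : L - (∑ i, ℓ i * αv i) • sj - (∑ i, ℓ i * βv i) • sj' ∈ T := by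
      have hdec : L - (∑ i, ℓ i * αv i) • sj - (∑ i, ℓ i * βv i) • sj' =
          ∑ i, ℓ i • ((X i : MvPolynomial (Fin n) (ResidueField A)) - αv i • sj - βv i • sj') := by
        conv_lhs => rw [hLsum]
        simp_rw [smul_sub, Finset.sum_sub_distrib, Finset.sum_smul, smul_smul, smul_eq_C_mul]
      rw [hdec]
      exact T.sum_mem fun i _ => T.smul_mem _ (hXi i)
    have hdiff : ((∑ i, ℓ i * αv i) - α) • sj + ((∑ i, ℓ i * βv i) - β) • sj' ∈ T := by
      have : ((∑ i, ℓ i * αv i) - α) • sj + ((∑ i, ℓ i * βv i) - β) • sj' =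
          (L - α • sj - β • sj') - (L - (∑ i, ℓ i * αv i) • sj - (∑ i, ℓ i * βv i) • sj') := by
        simp only [sub_smul]; abel
      rw [this]
      exact T.sub_mem h hmemT
    obtain ⟨h1, h2⟩ := eq_zero_of_pair_mem hx a hj hj' hdiff
    rw [sub_eq_zero] at h1 h2
    rw [hρL, h1, h2]
  have hsjS : sj ∈ homogeneousSubmodule (Fin n) (ResidueField A) 1 := by
    rw [hsj, ← range_linForm]; exact LinearMap.mem_range_self _ _
  have hsj'S : sj' ∈ homogeneousSubmodule (Fin n) (ResidueField A) 1 := by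
    rw [hsj', ← range_linForm]; exact LinearMap.mem_range_self _ _
  refine ⟨ρ, ?_, ?_, ?_⟩
  · -- `ρ` kills `T`, hence `T · k[X]`
    have hle : Ideal.span (T : Set (MvPolynomial (Fin n) (ResidueField A))) ≤ RingHom.ker ρ.toRingHom := by
      rw [Ideal.span_le]
      intro L hL
      have h := key (directrixSpace_le_one _ hL) (α := 0) (β := 0)
        (by rwa [zero_smul, zero_smul, sub_zero, sub_zero])
      simpa using h
    exact fun f hf => hle hf
  · have h := key hsjS (α := 1) (β := 0) (by rw [one_smul, zero_smul, sub_self, sub_zero]; exact T.zero_mem)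
    rwa [map_one, map_zero, zero_mul, add_zero] at h
  · have h := key hsj'S (α := 0) (β := 1) (by rw [one_smul, zero_smul, sub_zero, sub_self]; exact T.zero_mem)
    rwa [map_one, map_zero, one_mul, zero_add] at h

end LineMap

/-! ## The abstract chart: the ideal `𝔑` of `ℙ(Dir)` and the structure of `D/𝔑` -/

section Chart

variable {R : Type u} [CommRing R] (𝔭 : Ideal R) [𝔭.IsMaximal]
  (A : Type u) [CommRing A] [IsLocalRing A] [Algebra R A] [IsLocalization.AtPrime A 𝔭]
  {n : ℕ} {x : Fin n → A} (hx : Ideal.span (Set.range x) = maximalIdeal A) (he : (maximalIdeal A).spanFinrank = n)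
  {r : ℕ} {c : Fin r → R} (hc : Ideal.span (Set.range c) = 𝔭)
  (a : Fin r → Fin n → A) (ha : ∀ l, ∑ i, a l i * x i = algebraMap R A (c l))
  {D : Type v} [CommRing D] (ψ : R →+* D) (e : Fin r → D) (j j' : Fin r)
  (hce : ∀ l, ψ (c l) = ψ (c j) * e l) (hej : e j = 1)
  (hF1 : ∀ d : D, ∃ (m : ℕ) (F : MvPolynomial (Fin r) R), F.IsHomogeneous m ∧ MvPolynomial.eval₂Hom ψ e F = d)
  (hF2 : ∀ (m : ℕ) (F : MvPolynomial (Fin r) R), F.IsHomogeneous m →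
    ψ (MvPolynomial.eval c F) = ψ (c j) ^ m * MvPolynomial.eval₂Hom ψ e F)
  (hF3 : ∀ z : R, ψ z = 0 → ∃ K : ℕ, c j ^ K * z = 0)
  (hj : linForm (fun i => residue A (a j i)) ∉ directrixSpace (tangentConeIdeal x hx))
  (hj' : linForm (fun i => residue A (a j' i)) ∉
    directrixSpace (tangentConeIdeal x hx) ⊔ (ResidueField A) ∙ linForm (fun i => residue A (a j i)))
  (hd : directrixDim (tangentConeIdeal x hx) = 2)

omit [𝔭.IsMaximal] [IsLocalization.AtPrime A 𝔭] in
/-- `𝔭 · D ⊆ 𝔑`. [cite: CossartJannsenSaito2020, Def. 6.34 (i)] -/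
theorem map_le_chartIdeal : 𝔭.map ψ ≤ (𝔭.map ψ ⊔ Ideal.span {d : D | ∃ lam : Fin r → R,
          (linForm fun i => ∑ l, residue A (algebraMap R A (lam l)) * residue A (a l i)) ∈
            directrixSpace (tangentConeIdeal x hx) ∧ d = ∑ l, ψ (lam l) * e l}) := le_sup_left

omit [𝔭.IsMaximal] [IsLocalization.AtPrime A 𝔭] in
/-- The ratios `Σ_l λ_l e_l` with symbol in `𝒯` lie in `𝔑`. [cite: CossartJannsenSaito2020, Def. 6.34 (i)] -/
theorem sum_mul_mem_chartIdeal (lam : Fin r → R)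
    (hlam : (linForm fun i => ∑ l, residue A (algebraMap R A (lam l)) * residue A (a l i)) ∈
      directrixSpace (tangentConeIdeal x hx)) :
    ∑ l, ψ (lam l) * e l ∈ (𝔭.map ψ ⊔ Ideal.span {d : D | ∃ lam : Fin r → R,
          (linForm fun i => ∑ l, residue A (algebraMap R A (lam l)) * residue A (a l i)) ∈
            directrixSpace (tangentConeIdeal x hx) ∧ d = ∑ l, ψ (lam l) * e l}) :=
  Ideal.mem_sup_right (Ideal.subset_span ⟨lam, hlam, rfl⟩)

include hej in
/-- Padding a form by `Y_j` does not change its value on the chart (`e_j = 1`). [folklore] -/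
private theorem eval₂Hom_X_pow_mul (K : ℕ) (F : MvPolynomial (Fin r) R) :
    MvPolynomial.eval₂Hom ψ e (X j ^ K * F) = MvPolynomial.eval₂Hom ψ e F := by
  rw [map_mul, map_pow, MvPolynomial.eval₂Hom_X', hej, one_pow, one_mul]

include hej hF1 in
/-- **Every element of `𝔑` is the value of a form whose symbol lies in `𝒯 · k[X]`.** For the generators: `ψ(p)`, `p ∈ 𝔭`,
is the value of the degree-`0` form `p` with symbol `p̄ = 0`; `Σ λ_l e_l` is the value of the linear form `Σ λ_l Y_l` with
symbol `Σ λ̄_l s_l ∈ 𝒯`. Sums: pad by powers of `Y_j` (`e_j = 1`, symbol `s_j`); multiples `F'(e)·F(e) = (F'F)(e)`.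
[cite: CossartJannsenSaito2020, Def. 6.34 (i), §2.2] -/
theorem exists_form_symbolHom_mem_of_mem_chartIdeal {d : D} (hdN : d ∈ (𝔭.map ψ ⊔ Ideal.span {d : D | ∃ lam : Fin r → R,
          (linForm fun i => ∑ l, residue A (algebraMap R A (lam l)) * residue A (a l i)) ∈
            directrixSpace (tangentConeIdeal x hx) ∧ d = ∑ l, ψ (lam l) * e l})) :
    ∃ (N : ℕ) (F : MvPolynomial (Fin r) R), F.IsHomogeneous N ∧ MvPolynomial.eval₂Hom ψ e F = d ∧
      (MvPolynomial.eval₂Hom (MvPolynomial.C.comp ((residue A).comp (algebraMap R A)))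
          (fun l => linForm fun i => residue A (a l i))) F ∈
        Ideal.span (directrixSpace (tangentConeIdeal x hx) : Set (MvPolynomial (Fin n) (ResidueField A))) := by
  classical
  set 𝔗 := Ideal.span (directrixSpace (tangentConeIdeal x hx) : Set (MvPolynomial (Fin n) (ResidueField A))) with h𝔗
  -- `𝔑` as one span
  have hN : (𝔭.map ψ ⊔ Ideal.span {d : D | ∃ lam : Fin r → R,
          (linForm fun i => ∑ l, residue A (algebraMap R A (lam l)) * residue A (a l i)) ∈
            directrixSpace (tangentConeIdeal x hx) ∧ d = ∑ l, ψ (lam l) * e l}) =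
      Ideal.span ((ψ '' 𝔭) ∪ {d : D | ∃ lam : Fin r → R,
      (linForm fun i => ∑ l, residue A (algebraMap R A (lam l)) * residue A (a l i)) ∈
        directrixSpace (tangentConeIdeal x hx) ∧ d = ∑ l, ψ (lam l) * e l}) := by
    rw [Ideal.map, ← Submodule.span_union]
  rw [hN] at hdN
  refine Submodule.span_induction (p := fun d _ => ∃ (N : ℕ) (F : MvPolynomial (Fin r) R), F.IsHomogeneous N ∧
      MvPolynomial.eval₂Hom ψ e F = d ∧ (MvPolynomial.eval₂Hom (MvPolynomial.C.comp ((residue A).comp (algebraMap R A)))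
          (fun l => linForm fun i => residue A (a l i))) F ∈ 𝔗) ?_ ?_ ?_ ?_ hdN
  · -- generators
    rintro d (⟨p, hp, rfl⟩ | ⟨lam, hlam, rfl⟩)
    · refine ⟨0, C p, isHomogeneous_C _ _, by rw [MvPolynomial.eval₂Hom_C], ?_⟩
      rw [chartSymbolMap_C, (residue_eq_zero_iff _).mpr ((IsLocalization.AtPrime.to_map_mem_maximal_iff A 𝔭 p).mpr hp),
        map_zero]
      exact 𝔗.zero_mem
    · refine ⟨1, ∑ l, C (lam l) * X l, IsHomogeneous.sum _ _ _ fun l _ => isHomogeneous_C_mul_X _ _, ?_, ?_⟩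
      · rw [map_sum]
        exact Finset.sum_congr rfl fun l _ => by rw [map_mul, MvPolynomial.eval₂Hom_C, MvPolynomial.eval₂Hom_X']
      · rw [symbolHom_sum_C_mul_X]
        exact Ideal.subset_span hlam
  · exact ⟨0, 0, isHomogeneous_zero _ _ _, by rw [map_zero], by rw [map_zero]; exact 𝔗.zero_mem⟩
  · rintro d₁ d₂ - - ⟨N₁, F₁, hF₁, he₁, hs₁⟩ ⟨N₂, F₂, hF₂, he₂, hs₂⟩
    refine ⟨N₂ + N₁, X j ^ N₂ * F₁ + X j ^ N₁ * F₂, ?_, ?_, ?_⟩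
    · refine IsHomogeneous.add ?_ ?_
      · simpa using (isHomogeneous_X_pow (R := R) j N₂).mul hF₁
      · simpa [add_comm] using (isHomogeneous_X_pow (R := R) j N₁).mul hF₂
    · rw [map_add, eval₂Hom_X_pow_mul ψ e j hej, eval₂Hom_X_pow_mul ψ e j hej, he₁, he₂]
    · rw [map_add, map_mul, map_mul]
      exact 𝔗.add_mem (𝔗.mul_mem_left _ hs₁) (𝔗.mul_mem_left _ hs₂)
  · rintro d' d - ⟨N, F, hF, heF, hs⟩
    obtain ⟨m', F', hF', rfl⟩ := hF1 d'
    refine ⟨m' + N, F' * F, hF'.mul hF, by rw [map_mul, heF, smul_eq_mul], ?_⟩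
    rw [map_mul]
    exact 𝔗.mul_mem_left _ hs

include hx ha hej hF2 hF3 in
/-- **Two forms with the same value on the chart have congruent symbols**: if `F_1(e) = F_2(e)` with `F_i` homogeneous of
degree `m_i`, then `s_j^{K+m_2} Φ(F_1) − s_j^{K+m_1} Φ(F_2) ∈ J_x` for some `K` (`Y_j^{m_2}F_1 − Y_j^{m_1}F_2` is
killed by the chart, so `c_j^K` times its value at `c` vanishes; apply `symbolHom_mem_tangentConeIdeal` to
`Y_j^K(Y_j^{m_2}F_1 − Y_j^{m_1}F_2)`).
[cite: CossartJannsenSaito2020, §2.2 (p. 27); StacksProject, Tag 0804] -/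
theorem symbolHom_sub_mem_of_eval₂_eq {m₁ m₂ : ℕ} {F₁ F₂ : MvPolynomial (Fin r) R} (hF₁ : F₁.IsHomogeneous m₁)
    (hF₂ : F₂.IsHomogeneous m₂) (heq : MvPolynomial.eval₂Hom ψ e F₁ = MvPolynomial.eval₂Hom ψ e F₂) :
    ∃ K : ℕ, (linForm fun i => residue A (a j i)) ^ (K + m₂) *
        (MvPolynomial.eval₂Hom (MvPolynomial.C.comp ((residue A).comp (algebraMap R A)))
          (fun l => linForm fun i => residue A (a l i))) F₁ -
      (linForm fun i => residue A (a j i)) ^ (K + m₁) *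
        (MvPolynomial.eval₂Hom (MvPolynomial.C.comp ((residue A).comp (algebraMap R A)))
          (fun l => linForm fun i => residue A (a l i))) F₂ ∈ tangentConeIdeal x hx := by
  set G : MvPolynomial (Fin r) R := X j ^ m₂ * F₁ - X j ^ m₁ * F₂ with hG
  have hGhom : G.IsHomogeneous (m₁ + m₂) := by
    refine IsHomogeneous.sub ?_ ?_
    · simpa [add_comm] using (isHomogeneous_X_pow (R := R) j m₂).mul hF₁
    · simpa using (isHomogeneous_X_pow (R := R) j m₁).mul hF₂
  have hGe : MvPolynomial.eval₂Hom ψ e G = 0 := by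
    rw [hG, map_sub, eval₂Hom_X_pow_mul ψ e j hej, eval₂Hom_X_pow_mul ψ e j hej, heq, sub_self]
  have hψG : ψ (MvPolynomial.eval c G) = 0 := by
    rw [hF2 _ G hGhom, hGe, mul_zero]
  obtain ⟨K, hK⟩ := hF3 _ hψG
  set H : MvPolynomial (Fin r) R := X j ^ K * G with hH
  have hHhom : H.IsHomogeneous (K + (m₁ + m₂)) := by
    simpa using (isHomogeneous_X_pow (R := R) j K).mul hGhom
  have hHc : algebraMap R A (MvPolynomial.eval c H) ∈ maximalIdeal A ^ (K + (m₁ + m₂) + 1) := by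
    rw [hH, map_mul, map_pow, MvPolynomial.eval_X, hK, map_zero]
    exact Ideal.zero_mem _
  refine ⟨K, ?_⟩
  have hmem := symbolHom_mem_tangentConeIdeal A hx a ha hHhom hHc
  have hexp : (MvPolynomial.eval₂Hom (MvPolynomial.C.comp ((residue A).comp (algebraMap R A)))
          (fun l => linForm fun i => residue A (a l i))) H =
      (linForm fun i => residue A (a j i)) ^ (K + m₂) *
        (MvPolynomial.eval₂Hom (MvPolynomial.C.comp ((residue A).comp (algebraMap R A)))
          (fun l => linForm fun i => residue A (a l i))) F₁ -
      (linForm fun i => residue A (a j i)) ^ (K + m₁) *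
        (MvPolynomial.eval₂Hom (MvPolynomial.C.comp ((residue A).comp (algebraMap R A)))
          (fun l => linForm fun i => residue A (a l i))) F₂ := by
    rw [hH, hG, map_mul, map_pow, map_sub, map_mul, map_mul, map_pow, map_pow, chartSymbolMap_X]
    ring
  rwa [hexp] at hmem

include hx ha hej hF1 hF2 hF3 hj hj' hd in
/-- **Injectivity of `k[T] → D/𝔑`**: if `Σ_s ψ(p_s) t^s ∈ 𝔑` (`t = e_{j'} = c_{j'}/c_j`) for a polynomial `p ∈ R[T]`, then
all `p_s ∈ 𝔭`. The form `F_p = Σ_s p_s Y_{j'}^s Y_j^{M−s}` has the same value as a form with symbol in `𝒯·k[X]`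
(`exists_form_symbolHom_mem_of_mem_chartIdeal`), so `s_j^• Φ(F_p) ∈ J_x + 𝒯·k[X] = 𝒯·k[X]`
(`symbolHom_sub_mem_of_eval₂_eq`, `tangentConeIdeal_le_span_directrixSpace`); the line map `ρ` kills `𝒯·k[X]` and sends
`s_j ↦ 1`, `s_{j'} ↦ T`, so `Σ_s p̄_s T^s = 0`. [cite: CossartJannsenSaito2020, Def. 6.38 (ii), p. 105] -/
theorem coeff_mem_of_eval₂_mem_chartIdeal {p : Polynomial R}
    (hp : Polynomial.eval₂ ψ (e j') p ∈ (𝔭.map ψ ⊔ Ideal.span {d : D | ∃ lam : Fin r → R,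
          (linForm fun i => ∑ l, residue A (algebraMap R A (lam l)) * residue A (a l i)) ∈
            directrixSpace (tangentConeIdeal x hx) ∧ d = ∑ l, ψ (lam l) * e l})) (s : ℕ) : p.coeff s ∈ 𝔭 := by
  classical
  set sj := linForm (fun i => residue A (a j i)) with hsj
  set sj' := linForm (fun i => residue A (a j' i)) with hsj'
  set 𝔗 := Ideal.span (directrixSpace (tangentConeIdeal x hx) : Set (MvPolynomial (Fin n) (ResidueField A))) with h𝔗
  set M := p.natDegree with hM
  -- the form `F_p`
  set Fp : MvPolynomial (Fin r) R := ∑ s ∈ Finset.range (M + 1), C (p.coeff s) * (X j' ^ s * X j ^ (M - s)) with hFp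
  have hFphom : Fp.IsHomogeneous M := by
    refine IsHomogeneous.sum _ _ _ fun s hs => ?_
    have hs' : s ≤ M := Nat.lt_succ_iff.mp (Finset.mem_range.mp hs)
    have h := ((isHomogeneous_X_pow (R := R) j' s).mul (isHomogeneous_X_pow (R := R) j (M - s))).C_mul (p.coeff s)
    rwa [Nat.add_sub_cancel' hs'] at h
  have hFpe : MvPolynomial.eval₂Hom ψ e Fp = Polynomial.eval₂ ψ (e j') p := by
    rw [Polynomial.eval₂_eq_sum_range, hFp, map_sum]
    refine Finset.sum_congr rfl fun s _ => ?_
    rw [map_mul, map_mul, map_pow, map_pow, MvPolynomial.eval₂Hom_C, MvPolynomial.eval₂Hom_X',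
      MvPolynomial.eval₂Hom_X', hej, one_pow, mul_one]
  have hFpsymb : (MvPolynomial.eval₂Hom (MvPolynomial.C.comp ((residue A).comp (algebraMap R A)))
          (fun l => linForm fun i => residue A (a l i))) Fp = ∑ s ∈ Finset.range (M + 1),
      C (residue A (algebraMap R A (p.coeff s))) * (sj' ^ s * sj ^ (M - s)) := by
    rw [hFp, map_sum]
    refine Finset.sum_congr rfl fun s _ => ?_
    rw [map_mul, map_mul, map_pow, map_pow, chartSymbolMap_C, chartSymbolMap_X, chartSymbolMap_X]
  -- a second form for the same element, with symbol in `𝔗`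
  obtain ⟨N, F, hF, hFe, hFs⟩ :=
    exists_form_symbolHom_mem_of_mem_chartIdeal 𝔭 A hx a ψ e j hej hF1 hp
  obtain ⟨K, hK⟩ := symbolHom_sub_mem_of_eval₂_eq A hx a ha ψ e j hej hF2 hF3 hFphom hF (hFpe.trans hFe.symm)
  have hmem : sj ^ (K + N) *
        (MvPolynomial.eval₂Hom (MvPolynomial.C.comp ((residue A).comp (algebraMap R A)))
          (fun l => linForm fun i => residue A (a l i))) Fp ∈ 𝔗 := by
    have h1 : sj ^ (K + N) *
        (MvPolynomial.eval₂Hom (MvPolynomial.C.comp ((residue A).comp (algebraMap R A)))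
          (fun l => linForm fun i => residue A (a l i))) Fp - sj ^ (K + M) *
        (MvPolynomial.eval₂Hom (MvPolynomial.C.comp ((residue A).comp (algebraMap R A)))
          (fun l => linForm fun i => residue A (a l i))) F ∈ 𝔗 :=
      tangentConeIdeal_le_span_directrixSpace A hx hK
    have h2 : sj ^ (K + M) *
        (MvPolynomial.eval₂Hom (MvPolynomial.C.comp ((residue A).comp (algebraMap R A)))
          (fun l => linForm fun i => residue A (a l i))) F ∈ 𝔗 := 𝔗.mul_mem_left _ hFs
    have := 𝔗.add_mem h1 h2
    rwa [sub_add_cancel] at this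
  -- apply the line map
  obtain ⟨ρ, hρT, hρ1, hρ2⟩ := exists_lineMap hx a hj hj' hd
  have hρ := hρT _ hmem
  rw [map_mul, map_pow, hρ1, one_pow, one_mul, hFpsymb, map_sum] at hρ
  have hρ' : ∑ s ∈ Finset.range (M + 1),
      Polynomial.C (residue A (algebraMap R A (p.coeff s))) * Polynomial.X ^ s = 0 := by
    rw [← hρ]
    refine Finset.sum_congr rfl fun s _ => ?_
    rw [map_mul, map_mul, map_pow, map_pow, MvPolynomial.algHom_C, Polynomial.algebraMap_eq, hρ1, hρ2, one_pow,
      mul_one]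
  -- the mapped polynomial vanishes, hence all its coefficients
  have hmap : Polynomial.map ((residue A).comp (algebraMap R A)) p = 0 := by
    rw [← hρ']
    conv_lhs => rw [p.as_sum_range_C_mul_X_pow, Polynomial.map_sum]
    refine Finset.sum_congr rfl fun s _ => ?_
    rw [Polynomial.map_mul, Polynomial.map_pow, Polynomial.map_C, Polynomial.map_X, RingHom.comp_apply]
  have hcoeff : residue A (algebraMap R A (p.coeff s)) = 0 := by
    have := congrArg (fun q => Polynomial.coeff q s) hmap
    simpa [Polynomial.coeff_map] using this
  rw [residue_eq_zero_iff] at hcoeff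
  exact (IsLocalization.AtPrime.to_map_mem_maximal_iff A 𝔭 (p.coeff s)).mp hcoeff

include hej hF1 hj hj' hd in
/-- **Surjectivity of `k[T] → D/𝔑`**: every element of `D` is congruent modulo `𝔑` to `Σ_s ψ(p_s) t^s` for a polynomial
`p ∈ R[T]`. Each ratio `e_l` is `≡ ψ(α_l) + ψ(β_l) t`, where `s_l ≡ ᾱ_l s_j + β̄_l s_{j'} (mod 𝒯)` (the combination
`c_l − α_l c_j − β_l c_{j'}` has symbol in `𝒯`), and every element of `D` is a polynomial in the `e_l` over `ψ(R)`.
[cite: CossartJannsenSaito2020, Def. 6.38 (ii), p. 105] -/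
theorem exists_polynomial_sub_eval₂_mem_chartIdeal (d : D) :
    ∃ p : Polynomial R, d - Polynomial.eval₂ ψ (e j') p ∈ (𝔭.map ψ ⊔ Ideal.span {d : D | ∃ lam : Fin r → R,
          (linForm fun i => ∑ l, residue A (algebraMap R A (lam l)) * residue A (a l i)) ∈
            directrixSpace (tangentConeIdeal x hx) ∧ d = ∑ l, ψ (lam l) * e l}) := by
  classical
  -- coordinates of the symbols `s_l`, lifted to `R`
  have hcoord : ∀ l, ∃ α β : R, e l - (ψ α + ψ β * e j') ∈ (𝔭.map ψ ⊔ Ideal.span {d : D | ∃ lam : Fin r → R,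
          (linForm fun i => ∑ l, residue A (algebraMap R A (lam l)) * residue A (a l i)) ∈
            directrixSpace (tangentConeIdeal x hx) ∧ d = ∑ l, ψ (lam l) * e l}) := by
    intro l
    have hL : linForm (fun i => residue A (a l i)) ∈ homogeneousSubmodule (Fin n) (ResidueField A) 1 := by
      rw [← range_linForm]; exact LinearMap.mem_range_self _ _
    obtain ⟨αb, βb, hmem⟩ := exists_sub_sub_mem_of_pair hx a hj hj' hd hL
    obtain ⟨α, hα⟩ := exists_residue_algebraMap_eq 𝔭 A αb
    obtain ⟨β, hβ⟩ := exists_residue_algebraMap_eq 𝔭 A βb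
    refine ⟨α, β, ?_⟩
    -- the combination `λ = δ_l − α δ_j − β δ_{j'}`
    let lam : Fin r → R := fun m => (if m = l then 1 else 0) - (if m = j then α else 0) - (if m = j' then β else 0)
    have hsymb : (linForm fun i => ∑ m, residue A (algebraMap R A (lam m)) * residue A (a m i)) =
        linForm (fun i => residue A (a l i)) - αb • linForm (fun i => residue A (a j i)) -
          βb • linForm (fun i => residue A (a j' i)) := by
      have hfun : (fun i => ∑ m, residue A (algebraMap R A (lam m)) * residue A (a m i)) =
          (fun i => residue A (a l i)) - αb • (fun i => residue A (a j i)) - βb • (fun i => residue A (a j' i)) := by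
        funext i
        simp only [lam, map_sub, Pi.sub_apply, Pi.smul_apply, smul_eq_mul, sub_mul, Finset.sum_sub_distrib]
        simp only [apply_ite (algebraMap R A), apply_ite (residue A), map_one, map_zero, ite_mul, one_mul,
          zero_mul, Finset.sum_ite_eq', Finset.mem_univ, if_true, hα, hβ]
      rw [hfun, map_sub, map_sub, map_smul, map_smul]
    have hval : ∑ m, ψ (lam m) * e m = e l - (ψ α + ψ β * e j') := by
      simp only [lam, map_sub, sub_mul, Finset.sum_sub_distrib]
      simp only [apply_ite ψ, map_one, map_zero, ite_mul, one_mul, zero_mul, Finset.sum_ite_eq',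
        Finset.mem_univ, if_true, hej, mul_one]
      ring
    rw [← hval]
    exact sum_mul_mem_chartIdeal 𝔭 A hx a ψ e lam (hsymb ▸ hmem)
  choose α β hαβ using hcoord
  -- `d = F(e)`
  obtain ⟨m, F, -, rfl⟩ := hF1 d
  refine ⟨MvPolynomial.aeval (fun l => Polynomial.C (α l) + Polynomial.C (β l) * Polynomial.X) F, ?_⟩
  -- evaluate: `eval₂ ψ t (F(α + β T)) = F(ψ α + ψ β t)`
  have heval : Polynomial.eval₂ ψ (e j')
      (MvPolynomial.aeval (fun l => Polynomial.C (α l) + Polynomial.C (β l) * Polynomial.X) F) =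
      MvPolynomial.eval₂Hom ψ (fun l => ψ (α l) + ψ (β l) * e j') F := by
    have hhom : (Polynomial.eval₂RingHom ψ (e j')).comp
        (MvPolynomial.aeval (fun l => Polynomial.C (α l) + Polynomial.C (β l) * Polynomial.X) :
          MvPolynomial (Fin r) R →ₐ[R] Polynomial R).toRingHom =
        MvPolynomial.eval₂Hom ψ (fun l => ψ (α l) + ψ (β l) * e j') := by
      refine MvPolynomial.ringHom_ext (fun ρ => ?_) (fun l => ?_)
      · simp [Polynomial.eval₂_C]
      · simp [Polynomial.eval₂_add, Polynomial.eval₂_mul, Polynomial.eval₂_C, Polynomial.eval₂_X]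
    exact RingHom.congr_fun hhom F
  rw [heval]
  -- `F(e) − F(e') ∈ (e_l − e'_l) ⊆ 𝔑`
  have hcong : ∀ G : MvPolynomial (Fin r) R, MvPolynomial.eval₂Hom ψ e G -
      MvPolynomial.eval₂Hom ψ (fun l => ψ (α l) + ψ (β l) * e j') G ∈ (𝔭.map ψ ⊔ Ideal.span {d : D | ∃ lam : Fin r → R,
          (linForm fun i => ∑ l, residue A (algebraMap R A (lam l)) * residue A (a l i)) ∈
            directrixSpace (tangentConeIdeal x hx) ∧ d = ∑ l, ψ (lam l) * e l}) := by
    intro G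
    induction G using MvPolynomial.induction_on with
    | C ρ =>
      rw [MvPolynomial.eval₂Hom_C, MvPolynomial.eval₂Hom_C, sub_self]
      exact Ideal.zero_mem _
    | add p q hp hq =>
      have : MvPolynomial.eval₂Hom ψ e (p + q) -
            MvPolynomial.eval₂Hom ψ (fun l => ψ (α l) + ψ (β l) * e j') (p + q) =
          (MvPolynomial.eval₂Hom ψ e p - MvPolynomial.eval₂Hom ψ (fun l => ψ (α l) + ψ (β l) * e j') p) +
            (MvPolynomial.eval₂Hom ψ e q - MvPolynomial.eval₂Hom ψ (fun l => ψ (α l) + ψ (β l) * e j') q) := by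
        rw [map_add, map_add]; ring
      rw [this]
      exact Ideal.add_mem _ hp hq
    | mul_X p l hp =>
      have : MvPolynomial.eval₂Hom ψ e (p * X l) -
            MvPolynomial.eval₂Hom ψ (fun l => ψ (α l) + ψ (β l) * e j') (p * X l) =
          (MvPolynomial.eval₂Hom ψ e p - MvPolynomial.eval₂Hom ψ (fun l => ψ (α l) + ψ (β l) * e j') p) * e l +
            MvPolynomial.eval₂Hom ψ (fun l => ψ (α l) + ψ (β l) * e j') p * (e l - (ψ (α l) + ψ (β l) * e j')) := by
        rw [map_mul, map_mul, MvPolynomial.eval₂Hom_X', MvPolynomial.eval₂Hom_X']; ring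
      rw [this]
      exact Ideal.add_mem _ (Ideal.mul_mem_right _ _ hp) (Ideal.mul_mem_left _ _ (hαβ l))
  exact hcong F

include hx ha hej hF1 hF2 hF3 hj hj' hd in
/-- **`D/𝔑 ≅ k[T]`: the ring of `ℙ(Dir(A))` on the chart `c_j ≠ 0` is the polynomial ring in `t = c_{j'}/c_j` over the
residue field `k = R/𝔭`** — the chart `T ≠ ∞` of `C_1 = ℙ(Dir_x(X)) ≅ ℙ^1_{k(x)}` (CJS Def. 6.38 (ii), p. 105 L13). The
isomorphism sends `r̄ ↦ ψ(r)` and `T ↦ t` (`coeff_mem_of_eval₂_mem_chartIdeal` for injectivity,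
`exists_polynomial_sub_eval₂_mem_chartIdeal` for surjectivity, Mathlib `Ideal.polynomialQuotientEquivQuotientPolynomial`).
[cite: CossartJannsenSaito2020, Def. 6.38 (ii), p. 105] -/
theorem exists_ringEquiv_polynomial_quotient_chartIdeal :
    ∃ Ξ : Polynomial (R ⧸ 𝔭) ≃+* D ⧸ (𝔭.map ψ ⊔ Ideal.span {d : D | ∃ lam : Fin r → R,
          (linForm fun i => ∑ l, residue A (algebraMap R A (lam l)) * residue A (a l i)) ∈
            directrixSpace (tangentConeIdeal x hx) ∧ d = ∑ l, ψ (lam l) * e l}),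
      (∀ ρ : R, Ξ (Polynomial.C (Ideal.Quotient.mk 𝔭 ρ)) = Ideal.Quotient.mk _ (ψ ρ)) ∧
        Ξ Polynomial.X = Ideal.Quotient.mk _ (e j') := by
  set 𝔑 := (𝔭.map ψ ⊔ Ideal.span {d : D | ∃ lam : Fin r → R,
          (linForm fun i => ∑ l, residue A (algebraMap R A (lam l)) * residue A (a l i)) ∈
            directrixSpace (tangentConeIdeal x hx) ∧ d = ∑ l, ψ (lam l) * e l}) with h𝔑
  -- `Θ : R[T] → D/𝔑`
  let Θ : Polynomial R →+* D ⧸ 𝔑 := Polynomial.eval₂RingHom ((Ideal.Quotient.mk 𝔑).comp ψ) (Ideal.Quotient.mk 𝔑 (e j'))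
  have hΘ : ∀ p : Polynomial R, Θ p = Ideal.Quotient.mk 𝔑 (Polynomial.eval₂ ψ (e j') p) := fun p => by
    change Polynomial.eval₂ _ _ p = _
    rw [Polynomial.hom_eval₂]
  have hΘsurj : Function.Surjective Θ := by
    intro q
    obtain ⟨d, rfl⟩ := Ideal.Quotient.mk_surjective q
    obtain ⟨p, hp⟩ := exists_polynomial_sub_eval₂_mem_chartIdeal 𝔭 A hx a ψ e j j' hej hF1 hj hj' hd d
    refine ⟨p, ?_⟩
    rw [hΘ, Ideal.Quotient.eq]
    have := Submodule.neg_mem _ hp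
    rwa [neg_sub] at this
  have hker : RingHom.ker Θ = 𝔭.map (Polynomial.C : R →+* Polynomial R) := by
    ext p
    rw [RingHom.mem_ker, hΘ, Ideal.Quotient.eq_zero_iff_mem, Ideal.mem_map_C_iff]
    constructor
    · intro hp s
      exact coeff_mem_of_eval₂_mem_chartIdeal 𝔭 A hx a ha ψ e j j' hej hF1 hF2 hF3 hj hj' hd hp s
    · intro hp
      rw [Polynomial.eval₂_eq_sum_range]
      refine Ideal.sum_mem _ fun s _ => Ideal.mul_mem_right _ _ ?_
      exact map_le_chartIdeal 𝔭 A hx a ψ e (Ideal.mem_map_of_mem ψ (hp s))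
  -- assemble
  let Ξ₁ : Polynomial (R ⧸ 𝔭) ≃+* Polynomial R ⧸ (𝔭.map (Polynomial.C : R →+* Polynomial R)) :=
    Ideal.polynomialQuotientEquivQuotientPolynomial 𝔭
  let Ξ₂ : Polynomial R ⧸ (𝔭.map (Polynomial.C : R →+* Polynomial R)) ≃+* Polynomial R ⧸ RingHom.ker Θ :=
    Ideal.quotEquivOfEq hker.symm
  let Ξ₃ : Polynomial R ⧸ RingHom.ker Θ ≃+* D ⧸ 𝔑 := RingHom.quotientKerEquivOfSurjective hΘsurj
  refine ⟨Ξ₁.trans (Ξ₂.trans Ξ₃), fun ρ => ?_, ?_⟩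
  · have h1 : Ξ₁ (Polynomial.C (Ideal.Quotient.mk 𝔭 ρ)) = Ideal.Quotient.mk _ (Polynomial.C ρ) := by
      simp [Ξ₁, Ideal.polynomialQuotientEquivQuotientPolynomial]
    rw [RingEquiv.trans_apply, RingEquiv.trans_apply, h1]
    change Ξ₃ (Ideal.Quotient.mk _ (Polynomial.C ρ)) = _
    rw [RingHom.quotientKerEquivOfSurjective_apply_mk, hΘ, Polynomial.eval₂_C]
  · have h1 : Ξ₁ Polynomial.X = Ideal.Quotient.mk _ Polynomial.X := by
      simp [Ξ₁, Ideal.polynomialQuotientEquivQuotientPolynomial]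
    rw [RingEquiv.trans_apply, RingEquiv.trans_apply, h1]
    change Ξ₃ (Ideal.Quotient.mk _ Polynomial.X) = _
    rw [RingHom.quotientKerEquivOfSurjective_apply_mk, hΘ, Polynomial.eval₂_X]

end Chart

end Literature.RingTheory.HilbertSamuel

end
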